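import Literature.NumberTheory.LFunctions.PolynomialRootMoebiusRieszMeanConstant
import Literature.NumberTheory.LFunctions.PolynomialRootMoebiusSharpCutoff
import Literature.NumberTheory.Sieve.AletheiaZomleferFukshanskyGarcia2020Applications
import Summits.Parity.BatemanHorn.Theorems.SoloInformedLargeDivisorEquivalence

/-!
# SoloInformedSingularSeriesLimit — the hypothesis `(R1)` is a theorem: `-∑_{d ≤ D} μ(d) log d · ρ(d)/d → 𝔖`

Solo unit `solo-Parity-informed` (ideation tier, informed mode), session 8; `PLAN.md` §16, CLAIMS C37.

The conditional kernel schema of sessions 6–7 (`SoloInformedThreeRangeSchema`,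
`SoloInformedSchemaToConjE`, `SoloInformedLargeDivisorEquivalence`) carried ONE true-but-unformalised
hypothesis,
  `(R1)  -∑_{d ≤ D} μ(d) log d · ρ(d)/d → 𝔖 = hardyLittlewoodEConst`   (`ρ(d) = #{ν mod d : ν² ≡ -1}`),
a statement of prime-ideal-theorem strength for `ℚ(i)`.  This file PROVES it from two theorems of the
tree's `Literature/NumberTheory/LFunctions` topic (Landau 1903 via Perron for `H(s)/ζ_K(s)`):

* `tendsto_logRieszMean_moebius_rootCount_batemanHornConst_nat` — the log-Riesz mean
  `R(D) = ∑_{n ≤ D} μ(n)ρ_g(n)/n · log(D/n) → C(![g])` for a one-polynomial Bateman–Horn system;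
* `abs_sum_moebius_rootCount_div_le` — the sharp cut-off `M(x) = ∑_{n ≤ x} μ(n)ρ_g(n)/n` satisfies
  `|M(x)| ≤ C/(log x)²` (`x ≥ 2`),

through the identity `-∑_{n ≤ D} μ(n)ρ_g(n) log n / n = R(D) - log D · M(D)` and `log D · M(D) = O(1/log D)`.
Consequences (all now UNCONDITIONAL on the classical side):

* `tendsto_neg_sum_moebius_rootCount_log_div` — `(R1)` for every one-polynomial Bateman–Horn system `![g]`;
* `tendsto_neg_sum_moebius_log_rho_div` — `(R1)` verbatim in the binder form of the schema files;
* `isEquivalent_sum_vonMangoldt_iff_largeDivisorSum_isLittleO'` — for every `0 < ε < 1`,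
  `(∑_{n ≤ x} Λ(n²+1)) ~ 𝔖 x  ⟺  T(x; ⌊x^{1-ε}⌋) = o(x)`, where
  `T(x; D₀) = ∑_{n ≤ x} ∑_{d ∣ n²+1, d > D₀} μ(d) log d` (indexed by the cofactor `e = (n²+1)/d`).

(The prime-count corollaries — `T(x; ⌊x^{1-ε}⌋) = o(x)` for one `ε` implies `HardyLittlewoodConjE`, and the
three-range schema `(R2)_ε → (R3)_ε → HardyLittlewoodConjE` with its first range discharged — are one-line
applications of `SoloInformedSchemaToConjE` and live in the sequel file.)

No bearing on the truth of the conjecture: the open content is, exactly, the `o(1)`-per-`n` cancellation of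
`μ(d) log d` over the divisor pairs `(n, d)`, `d ∣ n² + 1`, `d > x^{1-ε}` (trivially `T = O(x (log x)²)`).

References: E. Landau, Math. Ann. 56 (1903) 645–670 [LandauMathAnn1903]; H. L. Montgomery,
R. C. Vaughan, *Multiplicative Number Theory I* (CUP 2007) §6.2, §8.4 [MontgomeryVaughan2007];
P. T. Bateman, R. A. Horn, Math. Comp. 16 (1962) 363–367 [BatemanHorn1962].
-/

namespace Summit.Parity.BatemanHorn.Theorems

open Finset Filter ArithmeticFunction Asymptotics Polynomial
open scoped ArithmeticFunction.Moebius Topology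
open Literature.NumberTheory.Sieve (hardyLittlewoodEConst hardyLittlewoodEConst_pos IsBatemanHornSystem
  batemanHornConst polyRootCountMod isBatemanHornSystem_X_sq_add_one HardyLittlewoodConjE)
open Literature.NumberTheory.Sieve.Iwaniec1978 (rho rem rho_eq_polyRootCountMod)
open Literature.NumberTheory.LFunctions (tendsto_logRieszMean_moebius_rootCount_batemanHornConst_nat
  abs_sum_moebius_rootCount_div_le)

/-- `log D · M(D) → 0`, where `M(D) = ∑_{n ≤ D} μ(n)ρ_g(n)/n` (from `|M(x)| ≤ C/(log x)²`). -/
theorem tendsto_log_mul_sum_moebius_rootCount_div {g : ℤ[X]} (hg : IsBatemanHornSystem ![g]) :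
    Tendsto (fun D : ℕ => Real.log (D : ℝ) *
      ∑ n ∈ Icc 1 D, (μ n : ℝ) * (polyRootCountMod ![g] n : ℝ) / n) atTop (𝓝 0) := by
  have hirr : Irreducible g := by simpa using hg.irreducible 0
  have hdeg : 0 < g.natDegree := by simpa using hg.natDegree_pos 0
  obtain ⟨C, hC⟩ := abs_sum_moebius_rootCount_div_le hirr hdeg
  have hlog : Tendsto (fun D : ℕ => Real.log (D : ℝ)) atTop atTop :=
    Real.tendsto_log_atTop.comp tendsto_natCast_atTop_atTop
  have hCdiv : Tendsto (fun D : ℕ => C / Real.log (D : ℝ)) atTop (𝓝 0) :=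
    tendsto_const_nhds.div_atTop hlog
  refine squeeze_zero_norm' ?_ hCdiv
  filter_upwards [eventually_ge_atTop 2] with D hD
  have hD : (2 : ℝ) ≤ D := by exact_mod_cast hD
  have hlogpos : 0 < Real.log (D : ℝ) := Real.log_pos (by linarith)
  have h := hC D hD
  rw [Nat.floor_natCast] at h
  rw [Real.norm_eq_abs, abs_mul, abs_of_pos hlogpos]
  calc Real.log (D : ℝ) * |∑ n ∈ Icc 1 D, (μ n : ℝ) * (polyRootCountMod ![g] n : ℝ) / n|
      ≤ Real.log (D : ℝ) * (C / Real.log (D : ℝ) ^ 2) := mul_le_mul_of_nonneg_left h hlogpos.le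
    _ = C / Real.log (D : ℝ) := by field_simp

/-- **`(R1)` for a one-polynomial Bateman–Horn system**: `-∑_{n ≤ D} μ(n) log n · ρ_g(n)/n → C(![g])`
(Landau's prime ideal theorem for `K = ℚ[X]/(g)`, in the tree as the log-Riesz mean with rate plus the
sharp cut-off bound; here de-smoothed through `-∑ μρ_g log n/n = R(D) - log D · M(D)`).
[cite: LandauMathAnn1903, Part II; MontgomeryVaughan2007, §8.4 Thm 8.9] -/
theorem tendsto_neg_sum_moebius_rootCount_log_div {g : ℤ[X]} (hg : IsBatemanHornSystem ![g]) :
    Tendsto (fun D : ℕ => -∑ n ∈ Icc 1 D,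
      (μ n : ℝ) * Real.log n * (polyRootCountMod ![g] n : ℝ) / n) atTop (𝓝 (batemanHornConst ![g])) := by
  have hR := tendsto_logRieszMean_moebius_rootCount_batemanHornConst_nat hg
  have hM := tendsto_log_mul_sum_moebius_rootCount_div hg
  have hmain := hR.sub hM
  rw [sub_zero] at hmain
  refine hmain.congr fun D => ?_
  rw [Finset.mul_sum, ← Finset.sum_sub_distrib, ← Finset.sum_neg_distrib]
  refine Finset.sum_congr rfl fun n hn => ?_
  have hn1 : 1 ≤ n := (Finset.mem_Icc.1 hn).1
  have hnD : n ≤ D := (Finset.mem_Icc.1 hn).2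
  have hn0 : (n : ℝ) ≠ 0 := by positivity
  have hD0 : (D : ℝ) ≠ 0 := by
    have : 1 ≤ D := hn1.trans hnD
    positivity
  rw [Real.log_div hD0 hn0]
  ring

/-- **`(R1)` of the schema files is a theorem**: `-∑_{d ≤ D} μ(d) log d · ρ(d)/d → 𝔖 = hardyLittlewoodEConst`,
in exactly the binder form of `isEquivalent_sum_vonMangoldt_of_threeRanges`,
`hardyLittlewoodConjE_of_threeRanges` and `isEquivalent_sum_vonMangoldt_iff_largeDivisorSum_isLittleO`.
[cite: LandauMathAnn1903, Part II] -/
theorem tendsto_neg_sum_moebius_log_rho_div :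
    Tendsto (fun D : ℕ => -∑ d ∈ Icc 1 D, (μ d : ℝ) * Real.log d * rho d / d) atTop
      (𝓝 hardyLittlewoodEConst) := by
  have h : Tendsto _ atTop (𝓝 hardyLittlewoodEConst) :=
    tendsto_neg_sum_moebius_rootCount_log_div isBatemanHornSystem_X_sq_add_one
  refine h.congr fun D => ?_
  simp only [rho_eq_polyRootCountMod]

/-- **`ψ_{n²+1}(x) ~ 𝔖 x` ⟺ the large-divisor Möbius–log sum is `o(x)`**, now with no side hypothesis
(any `0 < ε < 1`): the right-hand side is
`T(x; ⌊x^{1-ε}⌋) = ∑_{n ≤ x} ∑_{e ∣ n²+1, (n²+1)/e > ⌊x^{1-ε}⌋} μ((n²+1)/e) log((n²+1)/e) = o(x)`. -/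
theorem isEquivalent_sum_vonMangoldt_iff_largeDivisorSum_isLittleO' {ε : ℝ} (hε : 0 < ε) (hε1 : ε < 1) :
    ((fun x : ℕ => ∑ n ∈ Icc 1 x, Λ (n ^ 2 + 1)) ~[atTop]
        fun x : ℕ => hardyLittlewoodEConst * (x : ℝ))
      ↔ (fun x : ℕ => ∑ n ∈ Icc 1 x, ∑ e ∈ (n ^ 2 + 1).divisors with ⌊(x : ℝ) ^ (1 - ε)⌋₊ < (n ^ 2 + 1) / e,
            (μ ((n ^ 2 + 1) / e) : ℝ) * Real.log (((n ^ 2 + 1) / e : ℕ) : ℝ))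
          =o[atTop] fun x : ℕ => (x : ℝ) :=
  isEquivalent_sum_vonMangoldt_iff_largeDivisorSum_isLittleO hε hε1 tendsto_neg_sum_moebius_log_rho_div

end Summit.Parity.BatemanHorn.Theorems
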